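import Literature.Analysis.FluidPDE.CaloricRepresentationNu
import Literature.Analysis.FluidPDE.HeatKernelMultiplierDerivatives
import HarnessLib

/-!
# Reflected backward kernels as forward heat potentials

Analysis/FluidPDE support file (everything proved) in the decomposition of the named fact
`Literature.Analysis.FluidPDE.LemarieRieusset2016.lemma13_6_duhamel` (`CKNMorreyHolder.lean`:
Lemarié-Rieusset 2016, §13.9 Step 3, (13.50)–(13.52) and the proof of Lemma 13.6, pp. 474–478).
After the duality passage `∫ F · X = ∫ g̃ · (Ǩ ⋆ F)` (`CaloricRepresentationNu.lean`) every term
of the master identity is the pairing of the test function with a potential `Ǩ ⋆ F` of the data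
against a *reflected backward kernel*. This file identifies these potentials with the **forward**
objects in which the named fact is written (`heatPotential`, `multiplierHeatPotential` of
`ParabolicHeatPotentials.lean`):

* `convolution_reflect_backKernel_heatKernel` — for the heat kernel family,
  `Ǩ ⋆ F = heatPotential ν F` (`W₊(t - s, x - y) = G_{ν(t-s)}(y - x)`, evenness of `G`);
* `convolution_reflect_backKernel_heatKernelGrad`, `multiplierHeatPotential_derivSymbol_im` —
  for the heat-gradient family, `Ǩ ⋆ F = -Re (multiplierHeatPotential ν (derivSymbol c) F)` and
  the multiplier potential is real (the kernel of `∂_c e^{θΔ}` is `∂_cG_θ`,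
  `multiplierHeatKernel_derivSymbol`, which is odd);
* `convolution_reflect_backKernel_heatExtension` — **smearing lemma**: for the family
  `a ↦ e^{νaΔ}μ` of heat flows of a bounded integrable `μ`,
  `(Ǩ ⋆ F)(t, x) = heatPotential ν d (t, x)` with the smeared datum
  `d(s, y') = ∫ μ(y - y') F(s, y) dy` (Fubini in the two space variables on each time slice, the
  translation `y' = x + y''`, and `∫ G = 1` for the integrability of the right-hand side); with it
  `convolution_reflect_backKernel_heatD1` for the family `a ↦ ∂_c e^{νaΔ}λ` of a smooth compactly
  supported `λ` (`∂_c e^{aΔ}λ = e^{aΔ}∂_cλ`), the shape of the far-field pressure term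
  `∫ φ p 𝒰_ν[Λ∂_c g]` of the master identity;
* `heatPotential_ofReal` — heat potentials of real data cast to `ℂ` are real;
* `IsSliceBoundKernel.locallyIntegrable_convolution_reflect` — potentials of integrable data with
  bounded time support against slice-bound kernels are locally integrable (the absolute
  convergence `integrable_kernelPairing_swap` tested with indicators).

## Mathlib / tree search

Tree (all used): `backKernel`, `heatKernelGrad_eq`, `IsSliceBoundKernel` (`CaloricBackwardKernels`,
`CaloricKernelFamilies`), `convolution_reflect_lsmul_real_prod_apply` (`CaloricPotentialContinuity`),
`IsSliceBoundKernel.integrable_kernelPairing_swap` (`CaloricRepresentationNu`),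
`multiplierHeatKernel_derivSymbol` (`HeatKernelMultiplierDerivatives`), `heatPotential`,
`multiplierHeatPotential`, `heatKernelFwd` (`ParabolicHeatPotentials`), `heatExtension_apply`,
`norm_heatExtension_le`, `continuousOn_uncurry_heatExtension_of_memLp`,
`fderiv_heatExtension_apply_eq_heatExtension_fderiv`, `fderiv_heatKernel_apply_eq_mul_inner`
(`UnboundedOperators/*`). Mathlib: `integral_prod`, `integrable_prod_iff`,
`integral_integral_swap`, `lintegral_lintegral_swap`, `integral_add_left_eq_self`,
`Integrable.prod_right_ae`, `Integrable.integral_norm_prod_left`, `Integrable.bdd_mul`.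

## References

* P. G. Lemarié-Rieusset, *The Navier–Stokes Problem in the 21st Century*, CRC Press (2016),
  Prop. 13.4 p. 464 (the potentials `W₊ ⊛ f`, `(σ(D)W₊) ⊛ g`), §13.9 Step 3, (13.50)–(13.52),
  pp. 474–475. [LemarieRieusset2016]
-/

noncomputable section

open MeasureTheory Set Function Filter Metric Real ContinuousLinearMap TopologicalSpace
open scoped ENNReal NNReal Topology RealInnerProductSpace Convolution

namespace Literature.Analysis.FluidPDE

section General

variable {E : Type*} [NormedAddCommGroup E] [InnerProductSpace ℝ E] [FiniteDimensional ℝ E]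
  [MeasurableSpace E] [BorelSpace E]

/-! ### The heat kernel family: `Ǩ ⋆ F = W₊ ⊛ F` -/

omit [FiniteDimensional ℝ E] [MeasurableSpace E] [BorelSpace E] in
/-- The reflected backward heat kernel is the forward space–time heat kernel:
`backKernel (a ↦ G_{νa}) (z - w) = W₊(w - z)` (evenness of the Gaussian). [folklore] -/
theorem backKernel_heatKernel_sub_eq_heatKernelFwd (ν : ℝ) (z w : ℝ × E) :
    backKernel (fun a y => UnboundedOperators.heatKernel (E := E) (ν * a) y) (z - w) =
      heatKernelFwd ν (w - z) := by
  unfold backKernel heatKernelFwd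
  simp only [Prod.fst_sub, Prod.snd_sub, sub_neg]
  by_cases h : z.1 < w.1
  · have h' : 0 < w.1 - z.1 := sub_pos.2 h
    rw [if_pos h, if_pos h', neg_sub, ← UnboundedOperators.heatKernel_neg, neg_sub]
  · have h' : ¬0 < w.1 - z.1 := fun hh => h (sub_pos.1 hh)
    rw [if_neg h, if_neg h']

/-- **For the heat kernel family the reflected potential is the forward heat potential**:
`((backKernel (a ↦ G_{νa}))ˇ ⋆ F)(w) = heatPotential ν F (w)`. [folklore] -/
theorem convolution_reflect_backKernel_heatKernel (ν : ℝ) (F : ℝ × E → ℝ) (w : ℝ × E) :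
    ((fun v => backKernel (fun a y => UnboundedOperators.heatKernel (E := E) (ν * a) y) (-v))
        ⋆[lsmul ℝ ℝ, (volume : Measure (ℝ × E))] F) w =
      heatPotential ν F w := by
  rw [convolution_reflect_lsmul_real_prod_apply, heatPotential]
  refine integral_congr_ae (Eventually.of_forall fun z => ?_)
  dsimp only
  rw [backKernel_heatKernel_sub_eq_heatKernelFwd, smul_eq_mul]

/-- **Heat potentials of real data cast to `ℂ` are real.** [folklore] -/
theorem heatPotential_ofReal (ν : ℝ) (F : ℝ × E → ℝ) (z : ℝ × E) :
    heatPotential ν (fun w => (F w : ℂ)) z = ((heatPotential ν F z : ℝ) : ℂ) := by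
  simp only [heatPotential, smul_eq_mul, Complex.real_smul, ← Complex.ofReal_mul]
  exact integral_complex_ofReal

/-! ### Local integrability of reflected potentials -/

/-- **Potentials of integrable data against slice-bound kernels are locally integrable**: for
`K` slice-bound and `f ∈ L¹` with time support in `[a, b]`, `Ǩ ⋆ f` is locally integrable on
`ℝ × E` (test the absolute convergence of `integrable_kernelPairing_swap` with the indicator of a
compact box). [folklore] -/
theorem IsSliceBoundKernel.locallyIntegrable_convolution_reflect {K : ℝ × E → ℝ} {N : ℝ → ℝ}
    (hK : IsSliceBoundKernel K N) {f : ℝ × E → ℝ} (hf : Integrable f volume) {a b : ℝ}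
    (hfsupp : ∀ᵐ z ∂(volume : Measure (ℝ × E)), f z ≠ 0 → z.1 ∈ Icc a b) :
    LocallyIntegrable ((fun v => K (-v)) ⋆[lsmul ℝ ℝ, (volume : Measure (ℝ × E))] f) volume := by
  rw [locallyIntegrable_iff]
  intro k hk
  -- a compact box containing `k`
  obtain ⟨R, hR⟩ := hk.isBounded.subset_closedBall 0
  have hk1 : k ⊆ Icc (-R) R ×ˢ closedBall (0 : E) R := by
    intro z hz
    have h := hR hz
    rw [mem_closedBall_zero_iff] at h
    refine ⟨?_, ?_⟩
    · have h1 : |z.1| ≤ R := (norm_fst_le z).trans h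
      exact ⟨by linarith [neg_abs_le z.1], by linarith [le_abs_self z.1]⟩
    · rw [mem_closedBall_zero_iff]
      exact (norm_snd_le z).trans h
  set S : Set (ℝ × E) := Icc (-R) R ×ˢ closedBall (0 : E) R with hS_def
  have hSm : MeasurableSet S := measurableSet_Icc.prod measurableSet_closedBall
  have hSfin : volume S < ∞ := by
    rw [hS_def, Measure.volume_eq_prod, Measure.prod_prod]
    exact ENNReal.mul_lt_top measure_Icc_lt_top measure_closedBall_lt_top
  set g : ℝ × E → ℝ := S.indicator fun _ => 1 with hg_def
  have hgi : Integrable g volume := by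
    rw [hg_def, integrable_indicator_iff hSm]
    exact integrableOn_const hSfin.ne
  have hgM : ∀ᵐ w ∂(volume : Measure (ℝ × E)), |g w| ≤ 1 := ae_of_all _ fun w => by
    by_cases hw : w ∈ S
    · rw [hg_def, indicator_of_mem hw]; simp
    · rw [hg_def, indicator_of_notMem hw]; simp
  have hgsupp : ∀ᵐ w ∂(volume : Measure (ℝ × E)), g w ≠ 0 → w.1 ∈ Icc (-R) R :=
    ae_of_all _ fun w hw => by
      rw [hg_def] at hw
      by_contra h
      exact hw (indicator_of_notMem (fun hS => h hS.1) _)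
  have hpair := hK.integrable_kernelPairing_swap hf hfsupp hgi zero_le_one hgM hgsupp
  -- integrate out the data variable
  have h1 : Integrable (fun w : ℝ × E => ∫ z, f z * (K (z - w) * g w)) volume :=
    hpair.integral_prod_right
  have h2 : (fun w : ℝ × E => ∫ z, f z * (K (z - w) * g w)) =
      S.indicator ((fun v => K (-v)) ⋆[lsmul ℝ ℝ, (volume : Measure (ℝ × E))] f) := by
    funext w
    by_cases hw : w ∈ S
    · rw [indicator_of_mem hw, convolution_reflect_lsmul_real_prod_apply]
      refine integral_congr_ae (Eventually.of_forall fun z => ?_)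
      dsimp only
      rw [hg_def, indicator_of_mem hw]; ring
    · rw [indicator_of_notMem hw]
      have : g w = 0 := by rw [hg_def, indicator_of_notMem hw]
      simp [this]
  rw [h2, integrable_indicator_iff hSm] at h1
  exact h1.mono_set hk1

/-! ### The smearing lemma: heat flows of a bounded integrable profile -/

section Smearing

variable {μ : E → ℝ} {Cμ ν : ℝ} {F : ℝ × E → ℝ}

/-- The family `(a, y) ↦ e^{νaΔ}μ(y)` is jointly continuous on `(0, ∞) × E` for `μ ∈ L¹`,
`ν > 0`. [folklore] -/
theorem continuousOn_heatExtension_family_nu (hμi : Integrable μ volume) (hν : 0 < ν) :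
    ContinuousOn (fun q : ℝ × E => UnboundedOperators.heatExtension μ (ν * q.1) q.2)
      (Ioi 0 ×ˢ univ) := by
  have hμ1 : MemLp μ 1 volume := memLp_one_iff_integrable.2 hμi
  have h := UnboundedOperators.continuousOn_uncurry_heatExtension_of_memLp hμ1 le_rfl
  have hmap : ContinuousOn (fun q : ℝ × E => ((ν * q.1, q.2) : ℝ × E)) (Ioi 0 ×ˢ univ) :=
    (continuous_timeScaleMap ν).continuousOn
  have h2 := h.comp hmap (fun q hq => ⟨mul_pos hν hq.1, mem_univ _⟩)
  exact h2

/-- The backward kernel of the family `a ↦ e^{νaΔ}μ` is bounded by `max Cμ 0` when `|μ| ≤ Cμ`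
(maximum principle). [folklore] -/
theorem abs_backKernel_heatExtension_le (hμb : ∀ y, |μ y| ≤ Cμ) (hν : 0 < ν) (p : ℝ × E) :
    |backKernel (fun a y => UnboundedOperators.heatExtension μ (ν * a) y) p| ≤ max Cμ 0 := by
  unfold backKernel
  split_ifs with h
  · rw [← Real.norm_eq_abs]
    refine (UnboundedOperators.norm_heatExtension_le (C := max Cμ 0) (fun y => ?_)
      (mul_pos hν (neg_pos.2 h)) _)
    rw [Real.norm_eq_abs]
    exact (hμb y).trans (le_max_left _ _)
  · rw [abs_zero]; exact le_max_right _ _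

/-- The smeared datum `d(s, y') = ∫ μ(y - y') F(s, y) dy` is strongly measurable for
measurable `μ`, `F`. [folklore] -/
theorem stronglyMeasurable_smearedData (hμm : Measurable μ) (hFm : Measurable F) :
    StronglyMeasurable (fun q : ℝ × E => ∫ y, μ (y - q.2) * F (q.1, y)) := by
  have h : Measurable fun p : (ℝ × E) × E => μ (p.2 - p.1.2) * F (p.1.1, p.2) :=
    (hμm.comp (measurable_snd.sub (measurable_snd.comp measurable_fst))).mul
      (hFm.comp ((measurable_fst.comp measurable_fst).prodMk measurable_snd))
  exact h.stronglyMeasurable.integral_prod_right' (ν := (volume : Measure E))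

/-- Tonelli bound for the smeared datum on a time slice:
`∫⁻ G_θ(x - y') ‖∫ μ(y - y') F(s, y) dy‖ₑ dy' ≤ max Cμ 0 · ∫⁻ ‖F(s, y)‖ₑ dy` (`∫ G_θ = 1`,
`θ > 0`). [folklore] -/
theorem lintegral_heatKernel_mul_enorm_smearedData_le (hμb : ∀ y, |μ y| ≤ Cμ)
    {θ : ℝ} (hθ : 0 < θ) (x : E) (s : ℝ) :
    ∫⁻ y', ENNReal.ofReal (UnboundedOperators.heatKernel θ (x - y')) *
        ‖∫ y, μ (y - y') * F (s, y)‖ₑ ≤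
      ENNReal.ofReal (max Cμ 0) * ∫⁻ y, ‖F (s, y)‖ₑ := by
  set C : ℝ := max Cμ 0 with hC
  have hC0 : 0 ≤ C := le_max_right _ _
  have hμC : ∀ y, |μ y| ≤ C := fun y => (hμb y).trans (le_max_left _ _)
  -- bound the inner Bochner integral by a lower integral
  have h1 : ∀ y', ‖∫ y, μ (y - y') * F (s, y)‖ₑ ≤ ∫⁻ y, ENNReal.ofReal C * ‖F (s, y)‖ₑ := by
    intro y'
    refine (enorm_integral_le_lintegral_enorm _).trans (lintegral_mono fun y => ?_)
    rw [enorm_mul, Real.enorm_eq_ofReal_abs]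
    gcongr
    exact hμC _
  have hmeasG : Measurable fun y' : E => ENNReal.ofReal (UnboundedOperators.heatKernel θ (x - y')) :=
    ENNReal.measurable_ofReal.comp ((UnboundedOperators.continuous_heatKernel θ).measurable.comp
      (measurable_const.sub measurable_id))
  calc ∫⁻ y', ENNReal.ofReal (UnboundedOperators.heatKernel θ (x - y')) * ‖∫ y, μ (y - y') * F (s, y)‖ₑ
      ≤ ∫⁻ y', ENNReal.ofReal (UnboundedOperators.heatKernel θ (x - y')) *
          ∫⁻ y, ENNReal.ofReal C * ‖F (s, y)‖ₑ := lintegral_mono fun y' => by gcongr; exact h1 y'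
    _ = (∫⁻ y', ENNReal.ofReal (UnboundedOperators.heatKernel θ (x - y'))) *
          (ENNReal.ofReal C * ∫⁻ y, ‖F (s, y)‖ₑ) := by
        rw [lintegral_mul_const _ hmeasG, lintegral_const_mul' _ _ ENNReal.ofReal_ne_top]
    _ = ENNReal.ofReal C * ∫⁻ y, ‖F (s, y)‖ₑ := by
        have hmass : ∫⁻ y', ENNReal.ofReal (UnboundedOperators.heatKernel θ (x - y')) = 1 := by
          have h := lintegral_sub_left_eq_self (μ := (volume : Measure E))
            (fun y' : E => ENNReal.ofReal (UnboundedOperators.heatKernel θ y')) x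
          rw [h, ← ofReal_integral_eq_lintegral_ofReal
            (UnboundedOperators.integrable_heatKernel_holds hθ)
            (ae_of_all _ fun y => (UnboundedOperators.heatKernel_pos hθ y).le),
            UnboundedOperators.integral_heatKernel_eq_one_holds hθ, ENNReal.ofReal_one]
        rw [hmass, one_mul]

/-- The slice identity behind the smearing lemma: for `θ > 0` and an integrable slice
`F(s, ·)`, `∫ (e^{θΔ}μ)(y - x) F(s, y) dy = ∫ G_θ(x - y') (∫ μ(y - y') F(s, y) dy) dy'`
(Fubini on `E × E` and the translation `y' = x + y''`). [folklore] -/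
theorem integral_heatExtension_mul_slice_eq (hμm : Measurable μ) (hμb : ∀ y, |μ y| ≤ Cμ)
    (hFm : Measurable F) {s : ℝ} (hFs : Integrable (fun y => F (s, y)) volume) {θ : ℝ}
    (hθ : 0 < θ) (x : E) :
    ∫ y, UnboundedOperators.heatExtension μ θ (y - x) * F (s, y) =
      ∫ y', UnboundedOperators.heatKernel θ (x - y') * ∫ y, μ (y - y') * F (s, y) := by
  set C : ℝ := max Cμ 0 with hC
  have hμC : ∀ y, |μ y| ≤ C := fun y => (hμb y).trans (le_max_left _ _)
  -- the integrand on `E × E`, variables `(y', y)`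
  set Φ : E → E → ℝ := fun y' y =>
    UnboundedOperators.heatKernel θ (x - y') * (μ (y - y') * F (s, y)) with hΦ_def
  have hGi : Integrable (fun y' : E => UnboundedOperators.heatKernel θ (x - y')) volume :=
    (UnboundedOperators.integrable_heatKernel_holds hθ).comp_sub_left x
  have hΦm : AEStronglyMeasurable (uncurry Φ) ((volume : Measure E).prod volume) := by
    refine Measurable.aestronglyMeasurable ?_
    exact (((UnboundedOperators.continuous_heatKernel θ).measurable.comp
      (measurable_const.sub measurable_fst))).mul
      ((hμm.comp (measurable_snd.sub measurable_fst)).mul (hFm.comp (measurable_const.prodMk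
        measurable_snd)))
  have hΦi : Integrable (uncurry Φ) ((volume : Measure E).prod volume) := by
    refine (hGi.mul_prod ((hFs.norm).const_mul C)).mono' hΦm (Eventually.of_forall fun p => ?_)
    simp only [uncurry, hΦ_def]
    rw [norm_mul, norm_mul, Real.norm_of_nonneg (UnboundedOperators.heatKernel_pos hθ _).le,
      Real.norm_eq_abs, Real.norm_eq_abs]
    have hG0 := (UnboundedOperators.heatKernel_pos hθ (x - p.1)).le
    calc UnboundedOperators.heatKernel θ (x - p.1) * (|μ (p.2 - p.1)| * |F (s, p.2)|)
        ≤ UnboundedOperators.heatKernel θ (x - p.1) * (C * |F (s, p.2)|) := by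
          gcongr; exact hμC _
      _ = UnboundedOperators.heatKernel θ (x - p.1) * (C * ‖F (s, p.2)‖) := by
          rw [Real.norm_eq_abs]
  -- `∫ y', ∫ y, Φ = RHS`
  have hR : ∫ y', ∫ y, Φ y' y =
      ∫ y', UnboundedOperators.heatKernel θ (x - y') * ∫ y, μ (y - y') * F (s, y) := by
    refine integral_congr_ae (Eventually.of_forall fun y' => ?_)
    simp only [hΦ_def]
    exact integral_const_mul _ _
  -- `∫ y, ∫ y', Φ = LHS`
  have hL : ∫ y, ∫ y', Φ y' y = ∫ y, UnboundedOperators.heatExtension μ θ (y - x) * F (s, y) := by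
    refine integral_congr_ae (Eventually.of_forall fun y => ?_)
    simp only [hΦ_def]
    have h1 : (fun y' => UnboundedOperators.heatKernel θ (x - y') * (μ (y - y') * F (s, y))) =
        fun y' => (UnboundedOperators.heatKernel θ (x - y') * μ (y - y')) * F (s, y) := by
      funext y'; ring
    rw [h1, integral_mul_const, UnboundedOperators.heatExtension_apply]
    congr 1
    -- translate `y' = x + y''`
    have h2 := integral_add_left_eq_self
      (μ := (volume : Measure E)) (fun y' => UnboundedOperators.heatKernel θ (x - y') * μ (y - y')) x
    rw [← h2]
    refine integral_congr_ae (Eventually.of_forall fun y'' => ?_)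
    simp only [smul_eq_mul]
    rw [show x - (x + y'') = -y'' by abel, UnboundedOperators.heatKernel_neg,
      show y - (x + y'') = y - x - y'' by abel]
  rw [← hL, ← hR]
  exact (integral_integral_swap hΦi).symm

/-- **The smearing lemma**: for a measurable profile `μ` with `|μ| ≤ Cμ`, `μ ∈ L¹`, measurable
integrable space–time data `F`, and `ν > 0`, the reflected potential of `F` against the backward
kernel of the family `a ↦ e^{νaΔ}μ` is the forward heat potential of the smeared datum:
`((backKernel (a ↦ e^{νaΔ}μ))ˇ ⋆ F)(t, x) = heatPotential ν d (t, x)`,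
`d(s, y') = ∫ μ(y - y') F(s, y) dy` (`∫ 1_{s<t} (e^{ν(t-s)Δ}μ)(y - x) F(s, y) = ∫ 1_{s<t}
G_{ν(t-s)}(x - y') d(s, y')`, slice by slice). [folklore] -/
theorem convolution_reflect_backKernel_heatExtension (hμm : Measurable μ) (hμb : ∀ y, |μ y| ≤ Cμ)
    (hμi : Integrable μ volume) (hFm : Measurable F) (hF : Integrable F volume) (hν : 0 < ν)
    (w : ℝ × E) :
    ((fun v => backKernel (fun a y => UnboundedOperators.heatExtension μ (ν * a) y) (-v))
        ⋆[lsmul ℝ ℝ, (volume : Measure (ℝ × E))] F) w =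
      heatPotential ν (fun q : ℝ × E => ∫ y, μ (y - q.2) * F (q.1, y)) w := by
  obtain ⟨t, x⟩ := w
  set C : ℝ := max Cμ 0 with hC
  have hC0 : 0 ≤ C := le_max_right _ _
  set κ : ℝ → E → ℝ := fun a y => UnboundedOperators.heatExtension μ (ν * a) y with hκ
  set K : ℝ × E → ℝ := backKernel κ with hK_def
  have hKm : Measurable K := measurable_backKernel (continuousOn_heatExtension_family_nu hμi hν)
  have hKb : ∀ p, |K p| ≤ C := fun p => abs_backKernel_heatExtension_le hμb hν p
  set d : ℝ × E → ℝ := fun q => ∫ y, μ (y - q.2) * F (q.1, y) with hd_def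
  have hdm : StronglyMeasurable d := stronglyMeasurable_smearedData hμm hFm
  -- the two integrands on `ℝ × E`
  set A : ℝ × E → ℝ := fun z => K (z - (t, x)) * F z with hA_def
  set B : ℝ × E → ℝ := fun q => heatKernelFwd ν ((t, x) - q) * d q with hB_def
  have hLHS : ((fun v => K (-v)) ⋆[lsmul ℝ ℝ, (volume : Measure (ℝ × E))] F) (t, x) = ∫ z, A z :=
    convolution_reflect_lsmul_real_prod_apply K F (t, x)
  have hRHS : heatPotential ν d (t, x) = ∫ q, B q := by
    simp only [heatPotential, hB_def, smul_eq_mul]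
  rw [hLHS, hRHS]
  -- integrability of `A`
  have hAi : Integrable A volume := by
    refine hF.bdd_mul (c := C) ((hKm.comp (measurable_id.sub measurable_const)).aestronglyMeasurable)
      (ae_of_all _ fun z => ?_)
    rw [Real.norm_eq_abs]; exact hKb _
  -- measurability of `B`
  have hWm : Measurable fun q : ℝ × E => heatKernelFwd ν ((t, x) - q) := by
    have h1 : Measurable (heatKernelFwd (E := E) ν) := by
      have h2 : Measurable fun w : ℝ × E => UnboundedOperators.heatKernel (ν * w.1) w.2 := by
        unfold UnboundedOperators.heatKernel
        fun_prop
      unfold heatKernelFwd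
      exact Measurable.ite (measurableSet_lt measurable_const measurable_fst) h2 measurable_const
    exact h1.comp (measurable_const.sub measurable_id)
  have hBsm : StronglyMeasurable B := hWm.stronglyMeasurable.mul hdm
  have hBm : AEStronglyMeasurable B volume := hBsm.aestronglyMeasurable
  -- the slices of `F` are integrable for a.e. `s`
  have hFs : ∀ᵐ s : ℝ, Integrable (fun y => F (s, y)) volume := by
    have h := hF
    rw [Measure.volume_eq_prod] at h
    exact h.prod_right_ae
  -- Tonelli bound for the slices of `B`
  have hBslice : ∀ s : ℝ, ∫⁻ y', ‖B (s, y')‖ₑ ≤ ENNReal.ofReal C * ∫⁻ y, ‖F (s, y)‖ₑ := by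
    intro s
    by_cases hs : s < t
    · have hθ : 0 < ν * (t - s) := mul_pos hν (sub_pos.2 hs)
      have h1 : ∀ y', ‖B (s, y')‖ₑ = ENNReal.ofReal (UnboundedOperators.heatKernel (ν * (t - s)) (x - y')) *
          ‖∫ y, μ (y - y') * F (s, y)‖ₑ := by
        intro y'
        simp only [hB_def, hd_def, heatKernelFwd, Prod.fst_sub, Prod.snd_sub, sub_pos, hs, if_true]
        rw [enorm_mul, Real.enorm_eq_ofReal (UnboundedOperators.heatKernel_pos hθ _).le]
      simp only [h1]
      exact lintegral_heatKernel_mul_enorm_smearedData_le hμb hθ x s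
    · have h1 : ∀ y', B (s, y') = 0 := by
        intro y'
        simp only [hB_def, heatKernelFwd, Prod.fst_sub, sub_pos, hs, if_false, zero_mul]
      simp only [h1, enorm_zero, lintegral_zero, zero_le]
  -- integrability of `B`
  have hBi : Integrable B volume := by
    rw [Measure.volume_eq_prod]
    rw [integrable_prod_iff (hBsm.aestronglyMeasurable)]
    constructor
    · filter_upwards [hFs] with s hs
      refine ⟨(hBsm.comp_measurable (measurable_const.prodMk measurable_id)).aestronglyMeasurable, ?_⟩
      rw [hasFiniteIntegral_iff_enorm]
      refine (hBslice s).trans_lt (ENNReal.mul_lt_top ENNReal.ofReal_lt_top ?_)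
      exact hasFiniteIntegral_iff_enorm.1 hs.2
    · have hF' : Integrable F ((volume : Measure ℝ).prod (volume : Measure E)) := by
        rwa [← Measure.volume_eq_prod]
      refine (hF'.integral_norm_prod_left.const_mul C).mono'
        hBsm.aestronglyMeasurable.norm.integral_prod_right' ?_
      filter_upwards [hFs] with s hs
      rw [Real.norm_eq_abs, abs_of_nonneg (integral_nonneg fun _ => norm_nonneg _)]
      have hmB : AEStronglyMeasurable (fun y' => B (s, y')) volume :=
        (hBsm.comp_measurable (measurable_const.prodMk measurable_id)).aestronglyMeasurable
      have hmF : AEStronglyMeasurable (fun y => F (s, y)) volume :=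
        (hFm.comp (measurable_const.prodMk measurable_id)).aestronglyMeasurable
      have hfin : ∫⁻ y, ‖F (s, y)‖ₑ ≠ ∞ := (hasFiniteIntegral_iff_enorm.1 hs.2).ne
      rw [integral_norm_eq_lintegral_enorm hmB, integral_norm_eq_lintegral_enorm hmF]
      calc (∫⁻ y', ‖B (s, y')‖ₑ).toReal ≤ (ENNReal.ofReal C * ∫⁻ y, ‖F (s, y)‖ₑ).toReal :=
            ENNReal.toReal_mono (ENNReal.mul_ne_top ENNReal.ofReal_ne_top hfin) (hBslice s)
        _ = C * (∫⁻ y, ‖F (s, y)‖ₑ).toReal := by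
            rw [ENNReal.toReal_mul, ENNReal.toReal_ofReal hC0]
  -- both sides as iterated integrals
  have hA' : Integrable A ((volume : Measure ℝ).prod (volume : Measure E)) := by
    rwa [← Measure.volume_eq_prod]
  have hB' : Integrable B ((volume : Measure ℝ).prod (volume : Measure E)) := by
    rwa [← Measure.volume_eq_prod]
  rw [Measure.volume_eq_prod, integral_prod A hA', integral_prod B hB']
  refine integral_congr_ae ?_
  filter_upwards [hFs] with s hs
  by_cases hst : s < t
  · have hθ : 0 < ν * (t - s) := mul_pos hν (sub_pos.2 hst)
    have hAs : ∀ y, A (s, y) = UnboundedOperators.heatExtension μ (ν * (t - s)) (y - x) * F (s, y) := by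
      intro y
      simp only [hA_def, hK_def, hκ, backKernel, Prod.fst_sub, Prod.snd_sub, sub_neg, hst, if_true,
        neg_sub]
    have hBs : ∀ y', B (s, y') =
        UnboundedOperators.heatKernel (ν * (t - s)) (x - y') * ∫ y, μ (y - y') * F (s, y) := by
      intro y'
      simp only [hB_def, hd_def, heatKernelFwd, Prod.fst_sub, Prod.snd_sub, sub_pos, hst, if_true]
    simp only [hAs, hBs]
    exact integral_heatExtension_mul_slice_eq hμm hμb hFm hs hθ x
  · have hAs : ∀ y, A (s, y) = 0 := by
      intro y
      simp only [hA_def, hK_def, backKernel, Prod.fst_sub, sub_neg, hst, if_false, zero_mul]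
    have hBs : ∀ y', B (s, y') = 0 := by
      intro y'
      simp only [hB_def, heatKernelFwd, Prod.fst_sub, sub_pos, hst, if_false, zero_mul]
    simp only [hAs, hBs]

end Smearing

/-! ### The family `a ↦ ∂_c e^{νaΔ}λ` of a smooth compactly supported profile -/

/-- **Derivatives fall on smooth compactly supported data**: `heatD1 a c g = e^{aΔ}(∂_c g)` for
`g ∈ C_c^∞`, `a > 0`. [folklore] -/
theorem heatD1_eq_heatExtension_fderiv {g : E → ℝ} (hg : ContDiff ℝ ((⊤ : ℕ∞) : WithTop ℕ∞) g)
    (hgc : HasCompactSupport g) {a : ℝ} (ha : 0 < a) (c : E) :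
    heatD1 a c g = UnboundedOperators.heatExtension (fun y => fderiv ℝ g y c) a := by
  obtain ⟨hg₁, hg₁c⟩ := contDiff_hasCompactSupport_fderiv_apply hg hgc c
  have m0 := memLp_one_of_contDiff_hasCompactSupport hg hgc
  have m1 := memLp_one_of_contDiff_hasCompactSupport hg₁ hg₁c
  funext y
  exact UnboundedOperators.fderiv_heatExtension_apply_eq_heatExtension_fderiv
    (hg.of_le (by exact_mod_cast le_top)) m0 le_rfl m1 le_rfl ha y

/-- **The reflected potential against `backKernel (a ↦ heatD1 (νa) c λ)` is a forward heat
potential** of the datum smeared by `∂_cλ`: for `λ ∈ C_c^∞`, measurable integrable `F`, `ν > 0`,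
`((backKernel (a ↦ ∂_c e^{νaΔ}λ))ˇ ⋆ F)(w) = heatPotential ν (q ↦ ∫ ∂_cλ(y - q.2) F(q.1, y) dy) w`
(the far-field pressure term `∫ φ p 𝒰_ν[Λ ∂_c g]` of the master identity). [folklore] -/
theorem convolution_reflect_backKernel_heatD1 {lam : E → ℝ}
    (hlam : ContDiff ℝ ((⊤ : ℕ∞) : WithTop ℕ∞) lam) (hlamc : HasCompactSupport lam)
    {F : ℝ × E → ℝ} (hFm : Measurable F) (hF : Integrable F volume) {ν : ℝ} (hν : 0 < ν)
    (c : E) (w : ℝ × E) :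
    ((fun v => backKernel (fun a y => heatD1 (ν * a) c lam y) (-v))
        ⋆[lsmul ℝ ℝ, (volume : Measure (ℝ × E))] F) w =
      heatPotential ν (fun q : ℝ × E => ∫ y, fderiv ℝ lam (y - q.2) c * F (q.1, y)) w := by
  obtain ⟨hg₁, hg₁c⟩ := contDiff_hasCompactSupport_fderiv_apply hlam hlamc c
  -- the kernel family is `a ↦ e^{νaΔ}(∂_cλ)` on `a > 0`, which is all `backKernel` sees
  have hker : (fun v : ℝ × E => backKernel (fun a y => heatD1 (ν * a) c lam y) (-v)) =
      fun v => backKernel (fun a y => UnboundedOperators.heatExtension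
        (fun y' => fderiv ℝ lam y' c) (ν * a) y) (-v) := by
    funext v
    unfold backKernel
    split_ifs with h
    · dsimp only
      rw [heatD1_eq_heatExtension_fderiv hlam hlamc (mul_pos hν (neg_pos.2 h)) c]
    · rfl
  rw [hker]
  obtain ⟨M, hM⟩ := hg₁c.exists_bound_of_continuous hg₁.continuous
  refine convolution_reflect_backKernel_heatExtension (Cμ := M) (hg₁.continuous.measurable)
    (fun y => by rw [← Real.norm_eq_abs]; exact hM y)
    (hg₁.continuous.integrable_of_hasCompactSupport hg₁c) hFm hF hν w

end General

/-! ### The heat-gradient family: `Ǩ ⋆ F = -Re (∂_c W₊) ⊛ F` (dimension three) -/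

section Grad

/-- The forward multiplier kernel of `∂_c e^{θΔ}` is the real function
`1_{τ>0} ∂_cG_{ντ}(y)`. [folklore] -/
theorem multiplierHeatKernelFwd_derivSymbol {ν : ℝ} (hν : 0 < ν) (c : (EuclideanSpace ℝ (Fin 3))) (p : ℝ × (EuclideanSpace ℝ (Fin 3))) :
    multiplierHeatKernelFwd ν (derivSymbol c) p =
      (((if 0 < p.1 then fderiv ℝ (UnboundedOperators.heatKernel (ν * p.1)) p.2 c else 0) : ℝ) : ℂ) := by
  unfold multiplierHeatKernelFwd
  split_ifs with h
  · exact multiplierHeatKernel_derivSymbol (mul_pos hν h) c p.2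
  · simp

/-- The reflected backward heat-gradient kernel is minus the forward gradient kernel:
`backKernel (a ↦ ∂_cG_{νa}) (z - w) = -1_{w.1 > z.1} ∂_cG_{ν(w.1 - z.1)}(w.2 - z.2)` (the gradient
of the even Gaussian is odd). [folklore] -/
theorem backKernel_heatKernelGrad_sub_eq {ν : ℝ} (c : (EuclideanSpace ℝ (Fin 3))) (z w : ℝ × (EuclideanSpace ℝ (Fin 3))) :
    backKernel (fun a y => heatKernelGrad c (ν * a) y) (z - w) =
      -(if 0 < (w - z).1 then fderiv ℝ (UnboundedOperators.heatKernel (ν * (w - z).1)) (w - z).2 c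
        else 0) := by
  unfold backKernel
  simp only [Prod.fst_sub, Prod.snd_sub, sub_neg, sub_pos]
  by_cases h : z.1 < w.1
  · rw [if_pos h, if_pos h, heatKernelGrad_eq, UnboundedOperators.fderiv_heatKernel_apply_eq_mul_inner]
    simp only [neg_sub]
    rw [show z.2 - w.2 = -(w.2 - z.2) by abel, UnboundedOperators.heatKernel_neg, inner_neg_left]
    ring
  · rw [if_neg h, if_neg h, neg_zero]

/-- **The multiplier potential of `∂_c` on real data is real.** [folklore] -/
theorem multiplierHeatPotential_derivSymbol_eq_ofReal {ν : ℝ} (hν : 0 < ν) (c : (EuclideanSpace ℝ (Fin 3)))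
    (F : ℝ × (EuclideanSpace ℝ (Fin 3)) → ℝ) (w : ℝ × (EuclideanSpace ℝ (Fin 3))) :
    multiplierHeatPotential ν (derivSymbol c) F w =
      ((∫ z, (if 0 < (w - z).1 then fderiv ℝ (UnboundedOperators.heatKernel (ν * (w - z).1)) (w - z).2 c
        else 0) * F z : ℝ) : ℂ) := by
  rw [multiplierHeatPotential, ← integral_complex_ofReal]
  refine integral_congr_ae (Eventually.of_forall fun z => ?_)
  dsimp only
  rw [multiplierHeatKernelFwd_derivSymbol hν, ← Complex.ofReal_mul]

/-- The multiplier potential of `∂_c` on real data has vanishing imaginary part. [folklore] -/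
theorem multiplierHeatPotential_derivSymbol_im {ν : ℝ} (hν : 0 < ν) (c : (EuclideanSpace ℝ (Fin 3))) (F : ℝ × (EuclideanSpace ℝ (Fin 3)) → ℝ)
    (w : ℝ × (EuclideanSpace ℝ (Fin 3))) : (multiplierHeatPotential ν (derivSymbol c) F w).im = 0 := by
  rw [multiplierHeatPotential_derivSymbol_eq_ofReal hν, Complex.ofReal_im]

/-- **For the heat-gradient family the reflected potential is minus the real part of the forward
multiplier potential of `∂_c`**:
`((backKernel (a ↦ ∂_cG_{νa}))ˇ ⋆ F)(w) = -Re (multiplierHeatPotential ν (derivSymbol c) F w)`. [folklore] -/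
theorem convolution_reflect_backKernel_heatKernelGrad {ν : ℝ} (hν : 0 < ν) (c : (EuclideanSpace ℝ (Fin 3)))
    (F : ℝ × (EuclideanSpace ℝ (Fin 3)) → ℝ) (w : ℝ × (EuclideanSpace ℝ (Fin 3))) :
    ((fun v => backKernel (fun a y => heatKernelGrad c (ν * a) y) (-v))
        ⋆[lsmul ℝ ℝ, (volume : Measure (ℝ × (EuclideanSpace ℝ (Fin 3))))] F) w =
      -(multiplierHeatPotential ν (derivSymbol c) F w).re := by
  rw [multiplierHeatPotential_derivSymbol_eq_ofReal hν, Complex.ofReal_re,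
    convolution_reflect_lsmul_real_prod_apply, ← integral_neg]
  refine integral_congr_ae (Eventually.of_forall fun z => ?_)
  dsimp only
  rw [backKernel_heatKernelGrad_sub_eq, neg_mul]

end Grad

end Literature.Analysis.FluidPDE
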